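import Mathlib
import HarnessLib
import Summits.ValiantsHypothesis.ValiantsHypothesis.Theorems.LacunarySymmetroidMatrixDescartesProductPlusOneOneRiserLogistic
import Summits.ValiantsHypothesis.ValiantsHypothesis.Theorems.LacunarySymmetroidMatrixDescartesProductPlusOneLogConvexAlgebra

/-!
# LINE (A) `product_plus_one` — one-riser lemma: from a θ-TOWER of the pull to «Λ ↑, Z strictly ↑» (calculus layer, part 2, abstract)

Crux item stmt-ValiantsHypothesis-18050, LINE (A) floor structure (memo `pub/val-lit/lmr/NOTE-p7g15-18050-LINEA-incoherent-cell.md` §11–§12).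
Abstract over the cloud: a pull `P0 > 0` on `[x₁, x₄] ⊂ (0,∞)` with a tower `d/dx P0 = P1/x`, `d/dx P1 = P2/x`, `d/dx P2 = P3/x` (so `P_k = θ^k P0`,
`θ = x d/dx`), `P1 > 0`, and the two POINTWISE log-convexity facts of memo §12: `P1² ≤ P0·P2` (the pull is log-convex in `log x`) and
`(θN)² ≤ N·θ²N` for `N = P0² + P1 − p·P0`, `θN = 2P0P1 + P2 − pP1`, `θ²N = 2P1² + 2P0P2 + P3 − pP2`, plus `N > 0`.  Then, with
`Λ = P0 + P1/P0 − p = N/P0` and `Z = Λ + θΛ/Λ = P0 − p + θN/N`: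

* `tower_Lambda_hasDerivAt`, `tower_Lambda_pos`, `tower_Lambda_monotone` — `θΛ = P1 + (P0P2 − P1²)/P0² > 0`;
* `tower_Z_strictMono` — `θZ = P1 + (N·θ²N − (θN)²)/N² > 0`;
* ★★ `oneRiser_no_four_zeros_of_tower` — composed with ✓ `oneRiser_no_four_zeros_of_strictMonoZ`: a switched two-letter riser against such a pull
  has at most THREE zeros of the total Euler ratio on the interval.

Part 3 instantiates `P_k = Σ_i m_i θ^kψ_i` for a cloud of unswitched incoherent trinomials (✓/⧗ `…CloudCalculus`, `…LogConvexAlgebra`).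
Honest framing: real-variable calculus; NOT `OneChangeFloorK3` / `stub_classRowK3` / `stub_polyLaw` / `MatrixDescartes` / B; `VP ≠ VNP` NOT proved.
No definitions, no named facts; Mathlib only.
-/

set_option linter.dupNamespace false

namespace Summit.ValiantsHypothesis.ValiantsHypothesis.Theorems.LacunarySymmetroidMatrixDescartes

namespace ProductPlusOne

/-- `Λ = P0 + x·(P1/x)/P0 − p` has derivative `(P1 + (P0P2 − P1²)/P0²)/x` along the tower. -/
theorem tower_Lambda_hasDerivAt (p : ℝ) (P0 P1 P2 : ℝ → ℝ) {x : ℝ} (hx : 0 < x) (hP0 : 0 < P0 x)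
    (h0 : HasDerivAt P0 (P1 x / x) x) (h1 : HasDerivAt P1 (P2 x / x) x) :
    HasDerivAt (fun y => P0 y + y * (P1 y / y) / P0 y - p) ((P1 x + (P0 x * P2 x - P1 x ^ 2) / P0 x ^ 2) / x) x := by
  have hq := h1.div h0 hP0.ne'
  have hev : (fun y => P0 y + y * (P1 y / y) / P0 y - p) =ᶠ[nhds x] (fun y => P0 y + P1 y / P0 y - p) := by
    filter_upwards [Ioi_mem_nhds hx] with y hy
    rw [mul_div_cancel₀ _ (ne_of_gt hy)]
  have h' : HasDerivAt (fun y => P0 y + P1 y / P0 y - p) ((P1 x + (P0 x * P2 x - P1 x ^ 2) / P0 x ^ 2) / x) x := by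
    have h := (h0.add hq).sub_const p
    refine (h.congr_of_eventuallyEq (Filter.Eventually.of_forall fun y => ?_)).congr_deriv ?_
    · simp only [Pi.add_apply, Pi.div_apply]
    · have hP0' : P0 x ≠ 0 := hP0.ne'
      have hx' : x ≠ 0 := hx.ne'
      field_simp
  exact h'.congr_of_eventuallyEq hev

/-- `Λ = P0 + P1/P0 − p > 0` when `N = P0² + P1 − pP0 > 0`. -/
theorem tower_Lambda_pos (p : ℝ) {P0 P1 x : ℝ} (hx : 0 < x) (hP0 : 0 < P0) (hN : 0 < P0 ^ 2 + P1 - p * P0) :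
    0 < P0 + x * (P1 / x) / P0 - p := by
  rw [mul_div_cancel₀ _ hx.ne']
  have : P0 + P1 / P0 - p = (P0 ^ 2 + P1 - p * P0) / P0 := by field_simp
  rw [this]; positivity

/-- ★★ **From a θ-tower to at most three zeros.**  Riser `a − b x^p − c x^q` (`p = e₁+1`, `q = e₁+e₂+2`, `b, c > 0`) switched on
`[x₁, x₄] ⊂ (0, ∞)`; pull `P0` with tower `P1, P2, P3` (`d/dx P_k = P_{k+1}/x`), `P0, P1 > 0`, pull log-convex (`P1² ≤ P0P2`), and
`N = P0² + P1 − pP0 > 0` log-convex (`(θN)² ≤ N·θ²N`) on the interval.  Then `P/(b x^p + c x^q − a) − P0` has no four zeros `x₁ < x₂ < x₃ < x₄`.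
[this file's theorem] -/
theorem oneRiser_no_four_zeros_of_tower (e₁ e₂ : ℕ) {a b c : ℝ} (hb : 0 < b) (hc : 0 < c) (P0 P1 P2 P3 : ℝ → ℝ)
    {x₁ x₂ x₃ x₄ : ℝ} (h0 : 0 < x₁) (h12 : x₁ < x₂) (h23 : x₂ < x₃) (h34 : x₃ < x₄)
    (hsw : ∀ x ∈ Set.Icc x₁ x₄, a < b * x ^ (e₁ + 1) + c * x ^ (e₁ + e₂ + 2))
    (hP0pos : ∀ x ∈ Set.Icc x₁ x₄, 0 < P0 x) (hP1pos : ∀ x ∈ Set.Icc x₁ x₄, 0 < P1 x)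
    (hd0 : ∀ x ∈ Set.Icc x₁ x₄, HasDerivAt P0 (P1 x / x) x) (hd1 : ∀ x ∈ Set.Icc x₁ x₄, HasDerivAt P1 (P2 x / x) x)
    (hd2 : ∀ x ∈ Set.Icc x₁ x₄, HasDerivAt P2 (P3 x / x) x)
    (hlcP : ∀ x ∈ Set.Icc x₁ x₄, P1 x ^ 2 ≤ P0 x * P2 x)
    (hNpos : ∀ x ∈ Set.Icc x₁ x₄, 0 < P0 x ^ 2 + P1 x - ((e₁ : ℝ) + 1) * P0 x)
    (hlcN : ∀ x ∈ Set.Icc x₁ x₄,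
      (2 * P0 x * P1 x + P2 x - ((e₁ : ℝ) + 1) * P1 x) ^ 2
        ≤ (P0 x ^ 2 + P1 x - ((e₁ : ℝ) + 1) * P0 x) * (2 * P1 x ^ 2 + 2 * P0 x * P2 x + P3 x - ((e₁ : ℝ) + 1) * P2 x))
    (hzero : ∀ x ∈ ({x₁, x₂, x₃, x₄} : Set ℝ),
      (((e₁ : ℝ) + 1) * b * x ^ (e₁ + 1) + ((e₁ : ℝ) + e₂ + 2) * c * x ^ (e₁ + e₂ + 2))
          / (b * x ^ (e₁ + 1) + c * x ^ (e₁ + e₂ + 2) - a) - P0 x = 0) : False := by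
  set p : ℝ := (e₁ : ℝ) + 1 with hp
  -- the closed forms of θΛ and of Λ, Z
  set L1 : ℝ → ℝ := fun x => P1 x + (P0 x * P2 x - P1 x ^ 2) / P0 x ^ 2 with hL1
  set Λf : ℝ → ℝ := fun y => P0 y + y * (P1 y / y) / P0 y - p with hΛf
  have hΛeq : ∀ x, 0 < x → Λf x = P0 x + P1 x / P0 x - p := by
    intro x hx; simp only [hΛf]; rw [mul_div_cancel₀ _ hx.ne']
  have hΛder : ∀ x ∈ Set.Icc x₁ x₄, HasDerivAt Λf (L1 x / x) x := by
    intro x hx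
    have hx0 : 0 < x := h0.trans_le hx.1
    exact tower_Lambda_hasDerivAt p P0 P1 P2 hx0 (hP0pos x hx) (hd0 x hx) (hd1 x hx)
  have hL1pos : ∀ x ∈ Set.Icc x₁ x₄, 0 < L1 x := fun x hx =>
    cloud_theta_Lambda_pos (hP1pos x hx) (hlcP x hx)
  have hΛpos : ∀ x ∈ Set.Icc x₁ x₄, 0 < Λf x := by
    intro x hx
    have hx0 : 0 < x := h0.trans_le hx.1
    exact tower_Lambda_pos p hx0 (hP0pos x hx) (hNpos x hx)
  -- Λ monotone (derivative L1/x > 0)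
  have hΛmono : MonotoneOn Λf (Set.Icc x₁ x₄) := by
    have hcont : ContinuousOn Λf (Set.Icc x₁ x₄) := fun x hx => (hΛder x hx).continuousAt.continuousWithinAt
    refine (strictMonoOn_of_deriv_pos (convex_Icc x₁ x₄) hcont ?_).monotoneOn
    intro x hx
    rw [interior_Icc] at hx
    have hxI : x ∈ Set.Icc x₁ x₄ := Set.Ioo_subset_Icc_self hx
    rw [(hΛder x hxI).deriv]
    exact div_pos (hL1pos x hxI) (h0.trans_le hxI.1)
  -- Z through the N-form: `Λ + θΛ/Λ = P0 − p + θN/N`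
  set Nf : ℝ → ℝ := fun y => P0 y ^ 2 + P1 y - p * P0 y with hNf
  set N1f : ℝ → ℝ := fun y => 2 * P0 y * P1 y + P2 y - p * P1 y with hN1f
  set N2f : ℝ → ℝ := fun y => 2 * P1 y ^ 2 + 2 * P0 y * P2 y + P3 y - p * P2 y with hN2f
  set Zalt : ℝ → ℝ := fun y => P0 y - p + N1f y / Nf y with hZalt
  have hZeq : ∀ y ∈ Set.Icc x₁ x₄, Λf y + y * (L1 y / y) / Λf y = Zalt y := by
    intro y hy
    have hy0 : 0 < y := h0.trans_le hy.1
    have hP0 := (hP0pos y hy).ne'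
    have hN := (hNpos y hy).ne'
    rw [mul_div_cancel₀ _ hy0.ne', hΛeq y hy0]
    simp only [hZalt, hN1f, hNf, hL1]
    set Nv : ℝ := P0 y ^ 2 + P1 y - p * P0 y with hNv
    have hΛN : P0 y + P1 y / P0 y - p = Nv / P0 y := by rw [eq_div_iff hP0, hNv]; field_simp
    rw [hΛN]
    field_simp
    rw [hNv]
    ring
  have hZder : ∀ x ∈ Set.Icc x₁ x₄, ∃ Z' : ℝ, 0 < Z' ∧ HasDerivAt Zalt Z' x := by
    intro x hx
    have hx0 : 0 < x := h0.trans_le hx.1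
    have hN := hNpos x hx
    have hdN : HasDerivAt Nf (N1f x / x) x := by
      have := (((hd0 x hx).pow 2).add (hd1 x hx)).sub ((hd0 x hx).const_mul p)
      refine (this.congr_of_eventuallyEq (Filter.Eventually.of_forall fun t => ?_)).congr_deriv ?_
      · simp only [hNf, Pi.add_apply, Pi.sub_apply, Pi.pow_apply]
      · simp only [hN1f]; push_cast; field_simp
    have hdN1 : HasDerivAt N1f (N2f x / x) x := by
      have := ((((hd0 x hx).mul (hd1 x hx)).const_mul 2).add (hd2 x hx)).sub ((hd1 x hx).const_mul p)
      refine (this.congr_of_eventuallyEq (Filter.Eventually.of_forall fun t => ?_)).congr_deriv ?_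
      · simp only [hN1f, Pi.add_apply, Pi.sub_apply, Pi.mul_apply]; ring
      · simp only [hN2f]; field_simp
    have hZ' := ((hd0 x hx).sub_const p).add (hdN1.div hdN hN.ne')
    refine ⟨_, ?_, hZ'.congr_of_eventuallyEq (Filter.Eventually.of_forall fun t => by
      simp only [hZalt, Pi.add_apply, Pi.div_apply])⟩
    -- `P1/x + ((N2/x)·N − N1·(N1/x))/N² > 0`
    have hlc := hlcN x hx
    have h1 : 0 < P1 x / x := div_pos (hP1pos x hx) hx0
    have h2 : 0 ≤ (N2f x / x * Nf x - N1f x * (N1f x / x)) / Nf x ^ 2 := by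
      apply div_nonneg _ (sq_nonneg _)
      have : N2f x / x * Nf x - N1f x * (N1f x / x) = (Nf x * N2f x - N1f x ^ 2) / x := by
        field_simp
      rw [this]
      exact div_nonneg (by simp only [hNf, hN1f, hN2f]; linarith) hx0.le
    linarith
  have hZalt_mono : StrictMonoOn Zalt (Set.Icc x₁ x₄) := by
    have hcont : ContinuousOn Zalt (Set.Icc x₁ x₄) := fun x hx => by
      obtain ⟨Z', _, hZ'⟩ := hZder x hx
      exact hZ'.continuousAt.continuousWithinAt
    refine strictMonoOn_of_deriv_pos (convex_Icc x₁ x₄) hcont ?_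
    intro x hx
    rw [interior_Icc] at hx
    obtain ⟨Z', hZ'pos, hZ'⟩ := hZder x (Set.Ioo_subset_Icc_self hx)
    rw [hZ'.deriv]; exact hZ'pos
  have hZ : StrictMonoOn (fun y => Λf y + y * (L1 y / y) / Λf y) (Set.Icc x₁ x₄) := by
    intro u hu v hv huv
    show Λf u + u * (L1 u / u) / Λf u < Λf v + v * (L1 v / v) / Λf v
    rw [hZeq u hu, hZeq v hv]
    exact hZalt_mono hu hv huv
  -- feed the composed lemma with `Pl = P0`, `Pl' = P1/x`, `Λ' = L1/x`
  refine oneRiser_no_four_zeros_of_strictMonoZ e₁ e₂ hb hc P0 (fun x => P1 x / x) (fun x => L1 x / x)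
    h0 h12 h23 h34 hsw hP0pos hd0 ?_ ?_ ?_ ?_ hzero
  · intro x hx; have := hΛpos x hx; simpa only [hΛf, hp] using this
  · intro x hx; have := hΛder x hx; simpa only [hΛf, hp] using this
  · simpa only [hΛf, hp] using hΛmono
  · simpa only [hΛf, hp] using hZ

end ProductPlusOne

end Summit.ValiantsHypothesis.ValiantsHypothesis.Theorems.LacunarySymmetroidMatrixDescartes
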